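import Literature.AlgebraicGeometry.Frobenioids.PadicKummerIsoTransport
import Literature.AlgebraicGeometry.Frobenioids.PadicKummerRemark242Logic
import HarnessLib

/-!
# Frobenioids II, Remark 2.4.2: the unit-wise Frobenius WITNESS — a `Ψ` acting on `μ_N(A)` by the
# `n`-th power acts on `F_N(A)` by `n`, hence is incompatible with the invariant isomorphisms

Proof-only companion (abc-iut cell, layer L1, seat abc-iut-w5-d248; SUBDAG-FrdII-Thm24.md row L26
`UnitwiseFrobeniusWitness`, the WITNESS half — the LOGIC half is abc-iut-w5-d097's
`PadicKummerRemark242Logic.lean`) to abc-iut-L1-t7's `PadicKummerSetting.lean` and abc-iut-L1-d4's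
`PadicKummerIsoTransport.lean`. Authored by abc-iut-w5-d248 (gen 2).

S. Mochizuki, *The geometry of Frobenioids II*, Kyushu J. Math. **62** (2008) 401–460, Remark 2.4.2
p. 22 [cite: MochizukiFrdII2008, Rmk 2.4.2 p.22]: "if the `Φᵢ` fail to be fieldwise saturated, then it
is no longer possible in general to conclude that the isomorphism `F_N(A₁) ⥲ F_N(A₂)` is compatible
with the natural isomorphisms `F_N(Aᵢ) ⥲ ℤ/Nℤ`. For instance, when the `Φᵢ` are absolutely primitive,
an example of such a `Ψ` is provided by the unit-wise Frobenius functor of [FrdI], Proposition 2.9,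
(ii), which acts on `F_N(Aᵢ)` [relative to the natural isomorphisms `F_N(Aᵢ) ⥲ ℤ/Nℤ`] by raising to
the `ζ`-th power."

What is PROVED here, over the typed interface (`Def22Context`, `Def22Context.Iso`, the CONSTRUCTED
comparison data `Def22Context.Iso.thm24Data` with `isoFN` induced in continuous cohomology):

* (A) `ContinuousCohomology.map φ f n` (Mathlib) is ADDITIVE in the coefficient morphism `f`
  (`Kummer.contMap_add`, `contMap_zero`, `contMap_nsmul`), so the map induced by the identity of
  the group and the coefficient morphism `x ↦ m • x` is `m • 𝟙` (`Kummer.contMap_eq_nsmul_id`);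
* (B) for ANY isomorphism `e` of the Definition 2.2 data of `A` with itself which is the identity on
  `Aut_E(A_E)` and acts on `μ_N(A)` by the `n`-th power, the induced `F_N(A) ⥲ F_N(A)` is
  multiplication by `n` (`Def22Context.Iso.isoFN_eq_nsmul`) — hence `e` "acts on `F_N(A)` relative
  to the natural isomorphism `F_N(A) ⥲ ℤ/Nℤ` by raising to the `n`-th power" for EVERY such
  isomorphism `inv` (`actsOnFNByPower_of_muIso_eq_pow`), and is incompatible with `inv` as soon as
  `n ≢ 1 (mod N)` (`invariantIncompatible_of_muIso_eq_pow`, via abc-iut-w5-d097's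
  `invariantIncompatible_of_actsOnFNByPower`);
* (C) the WITNESS: if the `n`-th power map of `O^□(A)` is bijective (for `O^□(A) = O^×(A)`, `Φ`
  absolutely primitive: `n` prime to `p` and to the order of the torsion of `O^×(A)`), the
  Definition 2.2 data admit the automorphism "identity on `Aut_C(A)`, `Aut_E(A_E)`, `G`; `u ↦ uⁿ` on
  `O^□(A)`" (`Def22Context.exists_iso_pow`), and its comparison data act on `F_N(A)` by `n` and are
  `InvariantIncompatible` when `n ≢ 1 (mod N)` (`Def22Context.rmk242_witness`,
  `rmk242_witness_invariantIncompatible`); consequently the conclusion of Theorem 2.4 (ii) FAILS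
  for these data (`rmk242_witness_not_compatible`).

Honest framing: the context automorphism of (C) is the shadow, on the Definition 2.2 data of ONE
object, of print's unit-wise Frobenius functor ([FrdI] Prop. 2.9 (ii)(a)(c): identity on the base,
`ζ`-th power on `O^×(A)`; tree: `PreFrobenioid.UnitWiseFrobeniusZetaExists`, PROVED
`PreFrobenioid.unitWiseFrobeniusZetaExists`); the derivation of a `Def22Context.Iso` from a
self-equivalence of the `p`-adic Frobenioid CATEGORY is the binding step (`Def22Context` of an
object of abc-iut-L1-t4's `PadicFrd`), not done here. Nothing here concerns [IUTchIII]; no statement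
of [FrdII] is restated (the predicates are abc-iut-L1-t7's); typed ≠ proved for the binding.
-/

namespace Literature.AlgebraicGeometry.Frobenioids

open CategoryTheory

/-! ### (A) Additivity of `ContinuousCohomology.map` in the coefficient morphism -/

namespace Kummer

universe u v

section ContMapAdd

variable {k : Type u} [Ring k] [TopologicalSpace k]
variable {G H : Type v} [Group G] [TopologicalSpace G] [IsTopologicalGroup G]
  [Group H] [TopologicalSpace H] [IsTopologicalGroup H]
  {X : TopRep k G} {Y : TopRep k H}

/-- The level maps of the standard resolutions induced by `(φ, f)` are additive in the coefficient
morphism `f` (they are `F ↦ f ∘ F ∘ φ`). [cite: MochizukiFrdII2008, Rmk 2.4.2 p.22] -/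
theorem resolutionMap_add (φ : H →ₜ* G) (f g : TopRep.res (φ : H →* G) X ⟶ Y) (i : ℕ) :
    ContinuousCohomology.resolutionMap φ (f + g) i =
      ContinuousCohomology.resolutionMap φ f i + ContinuousCohomology.resolutionMap φ g i := by
  induction i with
  | zero => rfl
  | succ i ih =>
    rw [ContinuousCohomology.resolutionMap_succ, ContinuousCohomology.resolutionMap_succ,
      ContinuousCohomology.resolutionMap_succ, ih]
    ext F x
    rfl

/-- The cochain map on homogeneous cochains induced by `(φ, f)` is additive in `f`.
[cite: MochizukiFrdII2008, Rmk 2.4.2 p.22] -/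
theorem cochainsMap_add (φ : H →ₜ* G) (f g : TopRep.res (φ : H →* G) X ⟶ Y) :
    ContinuousCohomology.cochainsMap φ (f + g) =
      ContinuousCohomology.cochainsMap φ f + ContinuousCohomology.cochainsMap φ g := by
  ext i : 1
  rw [HomologicalComplex.add_f_apply, ContinuousCohomology.cochainsMap_f,
    ContinuousCohomology.cochainsMap_f, ContinuousCohomology.cochainsMap_f, resolutionMap_add]
  rfl

/-- The cochain map induced by `(φ, 0)` is zero. [cite: MochizukiFrdII2008, Rmk 2.4.2 p.22] -/
theorem cochainsMap_zero (φ : H →ₜ* G) :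
    ContinuousCohomology.cochainsMap φ (0 : TopRep.res (φ : H →* G) X ⟶ Y) = 0 := by
  have h := cochainsMap_add φ (0 : TopRep.res (φ : H →* G) X ⟶ Y) 0
  rw [add_zero] at h
  exact add_eq_left.mp h.symm

/-- **`Hⁿ(G, X) → Hⁿ(H, Y)` is additive in the coefficient morphism**: Mathlib's
`ContinuousCohomology.map φ (f + g) n = map φ f n + map φ g n`.
[cite: MochizukiFrdII2008, Rmk 2.4.2 p.22] -/
theorem contMap_add (φ : H →ₜ* G) (f g : TopRep.res (φ : H →* G) X ⟶ Y) (n : ℕ) :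
    ContinuousCohomology.map φ (f + g) n =
      ContinuousCohomology.map φ f n + ContinuousCohomology.map φ g n := by
  simp only [ContinuousCohomology.map, cochainsMap_add, HomologicalComplex.homologyMap_add]

/-- `ContinuousCohomology.map φ 0 n = 0`. [cite: MochizukiFrdII2008, Rmk 2.4.2 p.22] -/
theorem contMap_zero (φ : H →ₜ* G) (n : ℕ) :
    ContinuousCohomology.map φ (0 : TopRep.res (φ : H →* G) X ⟶ Y) n = 0 := by
  simp only [ContinuousCohomology.map, cochainsMap_zero, HomologicalComplex.homologyMap_zero]

/-- `ContinuousCohomology.map φ (m • f) n = m • map φ f n`. [cite: MochizukiFrdII2008, Rmk 2.4.2 p.22] -/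
theorem contMap_nsmul (φ : H →ₜ* G) (f : TopRep.res (φ : H →* G) X ⟶ Y) (m n : ℕ) :
    ContinuousCohomology.map φ (m • f) n = m • ContinuousCohomology.map φ f n := by
  induction m with
  | zero => rw [zero_nsmul, zero_nsmul, contMap_zero]
  | succ m ih => rw [succ_nsmul, succ_nsmul, contMap_add, ih]

end ContMapAdd

section ContMapNsmulId

variable {k : Type u} [Ring k] [TopologicalSpace k]
variable {K : Type v} [Group K] [TopologicalSpace K] [IsTopologicalGroup K]

/-- The map on `Hⁿ(K, X)` induced by the identity of `K` and the coefficient morphism `x ↦ m • x`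
is `m • 𝟙` (the `m`-analogue of `contMap_eq_id`). [cite: MochizukiFrdII2008, Rmk 2.4.2 p.22] -/
theorem contMap_eq_nsmul_id {X : TopRep k K} (θ : K →ₜ* K) (F : TopRep.res (θ : K →* K) X ⟶ X)
    (hθ : θ = ContinuousMonoidHom.id K) (m : ℕ) (hF : ∀ x : X, F.hom x = m • x) (n : ℕ) :
    ContinuousCohomology.map θ F n = m • 𝟙 _ := by
  subst hθ
  have h2 := contMap_nsmul (X := X) (Y := X) (ContinuousMonoidHom.id K) (𝟙 X) m n
  rw [ContinuousCohomology.map_id] at h2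
  convert h2 using 2
  exact TopRep.hom_ext (ContIntertwiningMap.ext (ContinuousLinearMap.ext fun x => hF x))

end ContMapNsmulId

/-- `Mu.val` commutes with powers. [cite: MochizukiFrdII2008, Def 2.1 (i) p.16] -/
theorem Mu.val_pow {N : ℕ} {O : Type} [CommMonoid O] (ζ : Mu N O) (n : ℕ) :
    (ζ ^ n).val = ζ.val ^ n := by
  induction n with
  | zero => rw [pow_zero, pow_zero, Mu.val_one]
  | succ m ih => rw [pow_succ, pow_succ, Mu.val_mul, ih]

end Kummer

/-! ### (B) A context isomorphism acting on `μ_N(A)` by the `n`-th power acts on `F_N(A)` by `n` -/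

namespace PadicKummer

open Kummer

namespace Def22Context.Iso

variable {X : Def22Context} (e : Def22Context.Iso X X) (N : ℕ)

/-- If `e` is the identity on `Aut_E(A_E)`, then `isoHA⁻¹` is the identity on `H_A`.
[cite: MochizukiFrdII2008, Rmk 2.4.2 p.22] -/
theorem isoHA_symm_eq_self_of_isoE (hE : ∀ τ : X.AutE, e.isoE τ = τ) (k : X.HA) :
    e.isoHA.symm k = k := by
  apply e.isoHA.injective
  rw [MulEquiv.apply_symm_apply]
  exact Subtype.ext (hE k).symm

/-- **Remark 2.4.2, the mechanism** (p. 22): for an isomorphism `e` of the Definition 2.2 data of `A`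
with itself which is the identity on `Aut_E(A_E)` and acts on `μ_N(A)` by the `n`-th power, the induced
isomorphism `F_N(A) ⥲ F_N(A)` of Theorem 2.4 (i) (transport in continuous cohomology
`H²(H_A, μ_N(A))`, then the quotient `F_N(A)`) is multiplication by `n`.
[cite: MochizukiFrdII2008, Rmk 2.4.2 p.22] -/
theorem isoFN_eq_nsmul (n : ℕ) (hE : ∀ τ : X.AutE, e.isoE τ = τ)
    (hμ : ∀ ζ : Mu N X.O, e.muIso N ζ = ζ ^ n) (x : FN X N) :
    e.isoFN N x = n • x := by
  induction x using QuotientAddGroup.induction_on with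
  | H y =>
    rw [isoFN_mk]
    have hpush : (e.transportMu N).push 2 = n • 𝟙 _ := by
      rw [InflTransport₂.push]
      exact contMap_eq_nsmul_id _ _
        (ContinuousMonoidHom.ext fun k => e.isoHA_symm_eq_self_of_isoE hE k) n
        (fun z => by
          show Additive.ofMul (e.muIso N (Additive.toMul z)) = n • z
          rw [hμ, ofMul_pow, ofMul_toMul]
          rfl) 2
    rw [hpush]
    rfl

/-- **Remark 2.4.2** (p. 22), "acts on `F_N(Aᵢ)` [relative to the natural isomorphisms
`F_N(Aᵢ) ⥲ ℤ/Nℤ`] by raising to the `ζ`-th power": such an `e` acts on `F_N(A)` by the `n`-th power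
relative to EVERY additive isomorphism `F_N(A) ⥲ ℤ/Nℤ`. [cite: MochizukiFrdII2008, Rmk 2.4.2 p.22] -/
theorem actsOnFNByPower_of_muIso_eq_pow (n : ℕ) (hE : ∀ τ : X.AutE, e.isoE τ = τ)
    (hμ : ∀ ζ : Mu N X.O, e.muIso N ζ = ζ ^ n) (inv : FNInvariant X N) :
    ActsOnFNByPower X X N (e.thm24Data N) inv inv (n : ZMod N) := by
  intro x
  show inv.toAddEquiv (e.isoFN N x) = (n : ZMod N) * inv.toAddEquiv x
  rw [e.isoFN_eq_nsmul N n hE hμ, map_nsmul, nsmul_eq_mul]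

/-- **Remark 2.4.2** (p. 22): such an `e` with `n ≢ 1 (mod N)` is NOT compatible with the natural
isomorphisms `F_N(A) ⥲ ℤ/Nℤ` (`InvariantIncompatible`). [cite: MochizukiFrdII2008, Rmk 2.4.2 p.22] -/
theorem invariantIncompatible_of_muIso_eq_pow (n : ℕ) (hE : ∀ τ : X.AutE, e.isoE τ = τ)
    (hμ : ∀ ζ : Mu N X.O, e.muIso N ζ = ζ ^ n) (hn : (n : ZMod N) ≠ 1) (inv : FNInvariant X N) :
    InvariantIncompatible X X N (e.thm24Data N) inv inv :=
  invariantIncompatible_of_actsOnFNByPower _ inv inv hn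
    (e.actsOnFNByPower_of_muIso_eq_pow N n hE hμ inv)

/-- If `e` acts on `O^□(A)` by the `n`-th power then it acts on `μ_N(A)` by the `n`-th power.
[cite: MochizukiFrdII2008, Rmk 2.4.2 p.22] -/
theorem muIso_eq_pow_of_isoO_eq_pow (n : ℕ) (hO : ∀ x : X.O, e.isoO x = x ^ n) (ζ : Mu N X.O) :
    e.muIso N ζ = ζ ^ n :=
  Mu.ext (Units.ext (by rw [coe_val_muIso, hO, Mu.val_pow, Units.val_pow_eq_pow_val]))

end Def22Context.Iso

/-! ### (C) The witness: the `n`-th power automorphism of the Definition 2.2 data -/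

namespace Def22Context

variable (X : Def22Context)

/-- **Remark 2.4.2, the witness on the Definition 2.2 data** (p. 22; [FrdI] Prop. 2.9 (ii)(a)(c): the
unit-wise Frobenius functor is the identity on the base and raises units to the `ζ`-th power): if
the `n`-th power map of `O^□(A)` is bijective, the Definition 2.2 data of `A` admit the automorphism
which is the identity on `Aut_C(A)`, `Aut_E(A_E)`, `G` and `u ↦ uⁿ` on `O^□(A)`.
[cite: MochizukiFrdII2008, Rmk 2.4.2 p.22] -/
theorem exists_iso_pow (n : ℕ) (hn : Function.Bijective fun x : X.O => x ^ n) :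
    ∃ e : Def22Context.Iso X X, (∀ x : X.O, e.isoO x = x ^ n) ∧ (∀ τ : X.AutE, e.isoE τ = τ) ∧
      (∀ α : X.AutC, e.isoC α = α) ∧ (∀ g : X.G, e.isoG g = g) :=
  ⟨{ isoC := MulEquiv.refl _
     isoO := MulEquiv.ofBijective (powMonoidHom n : X.O →* X.O) hn
     isoE := MulEquiv.refl _
     isoG := ContinuousMulEquiv.refl _
     res_isoC := fun _ => rfl
     isoO_smul := fun τ x => (smul_pow' τ x n).symm
     outer_isoG := fun _ => rfl
     map_H := (Iso.refl X).map_H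
     isGalois_iff := Iff.rfl }, fun _ => rfl, fun _ => rfl, fun _ => rfl, fun _ => rfl⟩

/-- **Remark 2.4.2, the witness** (p. 22): for a context whose `n`-th power map on `O^□(A)` is
bijective, the comparison data of Theorem 2.4 (i) CONSTRUCTED from the `n`-th power automorphism act
on `F_N(A)` — relative to ANY natural isomorphism `F_N(A) ⥲ ℤ/Nℤ` — by raising to the `n`-th power.
[cite: MochizukiFrdII2008, Rmk 2.4.2 p.22] -/
theorem rmk242_witness (N n : ℕ) (hn : Function.Bijective fun x : X.O => x ^ n)
    (inv : FNInvariant X N) :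
    ∃ e : Def22Context.Iso X X, (∀ x : X.O, e.isoO x = x ^ n) ∧ (∀ τ : X.AutE, e.isoE τ = τ) ∧
      ActsOnFNByPower X X N (e.thm24Data N) inv inv (n : ZMod N) := by
  obtain ⟨e, hO, hE, -, -⟩ := X.exists_iso_pow n hn
  exact ⟨e, hO, hE, e.actsOnFNByPower_of_muIso_eq_pow N n hE
    (e.muIso_eq_pow_of_isoO_eq_pow N n hO) inv⟩

/-- **Remark 2.4.2, the incompatibility** (p. 22): with `n ≢ 1 (mod N)` the comparison data of the
witness are `InvariantIncompatible` — "the natural isomorphisms `F_N(Aᵢ) ⥲ ℤ/Nℤ` are not, in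
general, compatible with the isomorphism `F_N(A₁) ⥲ F_N(A₂)` induced by `Ψ`".
[cite: MochizukiFrdII2008, Rmk 2.4.2 p.22] -/
theorem rmk242_witness_invariantIncompatible (N n : ℕ) (hn : Function.Bijective fun x : X.O => x ^ n)
    (hζ : (n : ZMod N) ≠ 1) (inv : FNInvariant X N) :
    ∃ e : Def22Context.Iso X X, (∀ x : X.O, e.isoO x = x ^ n) ∧ (∀ τ : X.AutE, e.isoE τ = τ) ∧
      InvariantIncompatible X X N (e.thm24Data N) inv inv := by
  obtain ⟨e, hO, hE, h⟩ := X.rmk242_witness N n hn inv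
  exact ⟨e, hO, hE, invariantIncompatible_of_actsOnFNByPower _ inv inv hζ h⟩

/-- **Remark 2.4.2, consequence for Theorem 2.4 (ii)** (p. 22: "it is no longer possible in general
to conclude that … is compatible"): for the witness data the compatibility asserted by the conclusion
of Theorem 2.4 (ii) FAILS; in particular `Thm24ii … fs fs …` forces `¬ fs` (such a `Ψ` lives over
non-fieldwise-saturated `Φ`). [cite: MochizukiFrdII2008, Rmk 2.4.2 p.22] -/
theorem rmk242_witness_not_compatible (N n : ℕ) (hn : Function.Bijective fun x : X.O => x ^ n)
    (hζ : (n : ZMod N) ≠ 1) (inv : FNInvariant X N) :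
    ∃ e : Def22Context.Iso X X, (∀ x : X.O, e.isoO x = x ^ n) ∧
      (¬ ∀ x : FN X N, inv.toAddEquiv ((e.thm24Data N).isoFN x) = inv.toAddEquiv x) ∧
      ∀ fs : Prop, Thm24ii X X N fs fs (e.thm24Data N) inv inv → ¬ fs := by
  obtain ⟨e, hO, -, h⟩ := X.rmk242_witness_invariantIncompatible N n hn hζ inv
  exact ⟨e, hO, not_thm24ii_conclusion_of_invariantIncompatible _ inv inv h,
    fun fs hii hfs => not_invariantIncompatible_of_thm24ii _ inv inv hii hfs hfs h⟩

end Def22Context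

end PadicKummer

end Literature.AlgebraicGeometry.Frobenioids
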